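import Summits.QuantumFields.BalabanUV.Beta.WilsonBackgroundWard22Point
import Summits.QuantumFields.BalabanUV.Beta.WilsonStencilDivergence
import Literature.MathematicalPhysics.QuantumFieldTheory.Balaban1983to89.Beta.WilsonVertex2Kron

/-!
# The second-order background-gauge Ward identity of the Wilson plaquette jets AS A QUADRATIC-FORM LAW IN COORDINATES — the frame of
# the (T2-S₂) Wilson table law (β sub-cell, row D1, (L4) W-side, Ward twin of (W-LET-S₂)₀; D1 formalisation swarm seat
# `b2b-balaban-beta-d1-formalise-leaf-09`, gen 4; CLAIM «D1-hW-L4-W22-TABLE-WARD», file 1)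

HONEST FRAMING (cell charter, verbatim): «discharging `BetaPertH` makes Bałaban's UV stability UNCONDITIONAL — a real
constructive-QFT result; it is NOT the continuum limit and NOT the Clay problem.»  HONEST DEPENDENCY (cell records, verbatim):
«continuum YM on T⁴ ⇐ BetaPertH ∧ nine spine estimates (0/9 proved); BetaPertH ⇐ (D1) ∧ (D4) ∧ CAP+tail; G-an2-4 gates asym, D1 and
NE2/3/4.»  DERIVED cell leaf: finite-dimensional algebra over an arbitrary finite abelian lattice, no estimate, no limit, nothing cited —
every statement is kernel-proved here ([folklore]); no `[cite:]` tag, no `def … : Prop`; the three `def`s below are coordinate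
bookkeeping (a letter family and two coordinate embeddings) asserting nothing.  By itself this file instantiates NO binder of the
β-function wall.  NOT D1, NOT `BetaPertH`, NOT continuum, NOT Clay.
ABSOLUTE RULE (cell charter, verbatim): «No internally-minted statement may enter as a cited fact. Every hypothesis is either
kernel-proved in this package or a verbatim quotation of a PUBLISHED theorem with page reference. The manuscript(s) under audit are
NOT citable for their own disputed steps — they are the thing under adjudication; programme-internal (2001/route/tribunal) claims are
never citable.»

## What and why

The hW END of the recursive wall family (`WardLocusRecursiveEnd`, socket `hWd`) is reduced by leaf-10's
`KernelWardSymAssembly.divW_W2SymOfK_eq_conjV_add_residuals` to LETTER-level table laws; for the Wilson slot of the level-0 bi-table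
(`T2RecAt 0 = cE₂ • wilsonW₂ d T + cB • vh₂S`) the law wanted (sockets `hS₂`/`hS₂''`) is the background DIVERGENCE of the Wilson
(2,2) table in one background slot = the commutator of the FIRST-order Wilson table with the generator of the gauge rotation (+ a
remainder).  Its ring-level input is this lineage's lattice identity `WilsonBackgroundWard22All.jet22_bgWard` (order `(W², B¹)` of the
background-gauge covariance of `τ U(∂p)`):
`4•[jet22 W (B + W₀λ) − jet22 W B − jet22 W (W₀λ)] + 4•[jet21 (W + adj λ W) B − jet21 W B − jet21 (adj λ W) B] + 2•jet21 W (rot λ B) = 0`.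
THIS FILE reads it in COORDINATES as a law of QUADRATIC FORMS in the fluctuation vector `v : Λ × (C × D) → ℝ` (`W = field t v`,
`λ = ℓ • Y`, any background `B`), through an3's dictionaries BY NAME — `PlaquetteVertex2Stencil.jet22_field_quadForm`
(`jet22 (field t v) B = v ⬝ᵥ hess22 B v`, every `B`) and `PlaquetteBackground.actionJet21_eq_wilsonVertexOp` (`jet21 (field t v) B =
−v ⬝ᵥ wilsonVertexOp (adM (B ·)) v`, every `B`).  THE ONE IDEA: the conjugated fluctuation `adj (ℓ • Y) (field t v)` is NOT a
coordinate field of the family `t` (that would need `[Y, t a] ∈ span t`, i.e. completeness / structure constants), but it IS the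
coordinate field of the ROTATED-LETTER EXTENSION `rotFam t Y y := t ⊕ (a ↦ Y·t a − t a·Y) ⊕ y` on the site-weighted coordinates placed in
the second summand (`field_rotFam_emb₁`, `adj_smul_field_rotFam`); the original fluctuation sits in the first summand
(`field_rotFam_emb₀`); the third summand `y : ι → 𝔸` is free room for background letters (used by the sequel to put `B` and `W₀λ` in
coordinates too).  No completeness, no structure constants, no colour trace is used.

* §0 `rotFam`, `emb₀`, `emb₁` (definitions asserting nothing) and their entries.
* §1 `field_add`, `field_rotFam_emb₀`, `field_rotFam_emb₁`, `adj_smul_field_rotFam`.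
* §2 `jet21_field_eq_neg_quadForm` (an3's headline ×(−2)), `jet21_polar_field` (the `W`-polarisation of the `(2,1)`-jet between two
  coordinate fields of ONE family is `−(V ⬝ᵥ M W + W ⬝ᵥ M V)`, `M = wilsonVertexOp e (adM τ T (B ·))`), `rotBackground_smul`.
* §3 **`bgWard22_quadForm`** — for every finite lattice `Λ` with frame `e`, normed real algebra `𝔸`, tracial `τ`, letter family `t`,
  letters `Y`, `y`, background `B`, site profile `ℓ` and fluctuation `v`:
  `4·V₀ ⬝ᵥ (hess22 T (B + W₀) − hess22 T B − hess22 T W₀) V₀ − 4·(V₀ ⬝ᵥ M_B V₁ + V₁ ⬝ᵥ M_B V₀) − 2·V₀ ⬝ᵥ M_rot V₀ = 0`,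
  `T = rotFam t Y y`, `V₀ = emb₀ v`, `V₁ = emb₁ (ℓ ⊙ v)`, `W₀ = gaugeDir₀ e (ℓ • Y)`, `M_B = wilsonVertexOp e (adM τ T (B ·))`,
  `M_rot = wilsonVertexOp e (z γ ↦ adM τ T ((ℓ z + ℓ (z + e γ)) • (Y·B z γ − B z γ·Y)))`.
NOT HERE (sequel, same claim): the ENTRYWISE law with colour (test vectors; `B`, `W₀` in the coordinates of the third summand via
`WilsonVertex2Kron.hess22_field_eq_sum_wilsonVertex₂`; `wilsonVertex₁_apply_eq_mul` on the (in₀, in₁) colour block), the fluctuation-colour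
trace, the transport to `ℤ^{d+1}` and the packed-fibre socket form for `WilsonBiStencil.wilsonW₂` / `StepJetData.wilsonA`.
Provenance: pub-balaban β sub-cell, D1 formalisation swarm, unit `b2b-balaban-beta-d1-formalise-leaf-09` gen 4, 2026-08-20 (v1); over
this lineage's `WilsonBackgroundWard22All/Point`, leaf-05-g2's `WilsonStencilDivergence` (`siteMul`, `adj_smul_field`) and an3's
`PlaquetteVertex*` / `PlaquetteBackground` / `WilsonVertex2Kron` BY NAME; no existing file touched.
-/

namespace Summit.QuantumFields.BalabanUV.Beta.WilsonBiStencilWardFrame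

open Finset
open scoped BigOperators Matrix
open Literature.MathematicalPhysics.QuantumFieldTheory.Balaban1983to89.Beta
open Literature.MathematicalPhysics.QuantumFieldTheory.Balaban1983to89.Beta.PlaquetteVertex (field adM jet21)
open Literature.MathematicalPhysics.QuantumFieldTheory.Balaban1983to89.Beta.PlaquetteVertex2 (jet22)
open Literature.MathematicalPhysics.QuantumFieldTheory.Balaban1983to89.Beta.PlaquetteVertex2Stencil (hess22 jet22_field_quadForm)
open Literature.MathematicalPhysics.QuantumFieldTheory.Balaban1983to89.Beta.PlaquetteBackground (wilsonVertexOp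
  actionJet21_eq_wilsonVertexOp)
open Literature.MathematicalPhysics.QuantumFieldTheory.Balaban1983to89.Beta.WilsonWardJets (gaugeDir₀)
open Summit.QuantumFields.BalabanUV.Beta.WilsonJetDivergence (adj adj_apply)
open Summit.QuantumFields.BalabanUV.Beta.WilsonStencilDivergence (siteMul siteMul_apply adj_smul_field)
open Summit.QuantumFields.BalabanUV.Beta.WilsonBackgroundWard22All (jet22_bgWard)

/-! ## §0 The rotated-letter extension of a letter family and the two coordinate embeddings -/

section Defs

variable {𝔸 : Type*} [Ring 𝔸] {Λ : Type*} {C : Type*} {ι : Type*} {D : Type*}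

/-- [folklore] THE ROTATED-LETTER EXTENSION of the letter family `t` by the letter `Y` (and spare letters `y`): on the first summand the
family itself, on the second the rotated letters `a ↦ Y·t a − t a·Y`, on the third the spare letters.  A definition asserting nothing. -/
def rotFam (t : C → 𝔸) (Y : 𝔸) (y : ι → 𝔸) : C ⊕ (C ⊕ ι) → 𝔸 :=
  Sum.elim t (Sum.elim (fun a => Y * t a - t a * Y) y)

variable (ι)

/-- [folklore] fluctuation coordinates EMBEDDED INTO THE FIRST SUMMAND of the extended colour index (zero elsewhere).  A definition
asserting nothing. -/
def emb₀ (v : Λ × (C × D) → ℝ) : Λ × ((C ⊕ (C ⊕ ι)) × D) → ℝ := fun p =>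
  match p with
  | (x, (Sum.inl a, k)) => v (x, (a, k))
  | (_, (Sum.inr _, _)) => 0

/-- [folklore] fluctuation coordinates EMBEDDED INTO THE SECOND SUMMAND (the rotated letters) of the extended colour index (zero
elsewhere).  A definition asserting nothing. -/
def emb₁ (v : Λ × (C × D) → ℝ) : Λ × ((C ⊕ (C ⊕ ι)) × D) → ℝ := fun p =>
  match p with
  | (_, (Sum.inl _, _)) => 0
  | (x, (Sum.inr (Sum.inl a), k)) => v (x, (a, k))
  | (_, (Sum.inr (Sum.inr _), _)) => 0

variable {ι}

/-- [folklore] the family on the first summand. -/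
@[simp] theorem rotFam_inl (t : C → 𝔸) (Y : 𝔸) (y : ι → 𝔸) (a : C) : rotFam t Y y (Sum.inl a) = t a := rfl

/-- [folklore] the family on the second summand: the rotated letters. -/
@[simp] theorem rotFam_inr_inl (t : C → 𝔸) (Y : 𝔸) (y : ι → 𝔸) (a : C) :
    rotFam t Y y (Sum.inr (Sum.inl a)) = Y * t a - t a * Y := rfl

/-- [folklore] the family on the third summand: the spare letters. -/
@[simp] theorem rotFam_inr_inr (t : C → 𝔸) (Y : 𝔸) (y : ι → 𝔸) (i : ι) : rotFam t Y y (Sum.inr (Sum.inr i)) = y i := rfl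

/-- [folklore] entries of `emb₀` on the first summand. -/
@[simp] theorem emb₀_inl (v : Λ × (C × D) → ℝ) (x : Λ) (a : C) (k : D) : emb₀ ι v (x, (Sum.inl a, k)) = v (x, (a, k)) := rfl

/-- [folklore] entries of `emb₀` off the first summand. -/
@[simp] theorem emb₀_inr (v : Λ × (C × D) → ℝ) (x : Λ) (c : C ⊕ ι) (k : D) : emb₀ ι v (x, (Sum.inr c, k)) = 0 := rfl

/-- [folklore] entries of `emb₁` on the first summand. -/
@[simp] theorem emb₁_inl (v : Λ × (C × D) → ℝ) (x : Λ) (a : C) (k : D) : emb₁ ι v (x, (Sum.inl a, k)) = 0 := rfl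

/-- [folklore] entries of `emb₁` on the second summand. -/
@[simp] theorem emb₁_inr_inl (v : Λ × (C × D) → ℝ) (x : Λ) (a : C) (k : D) :
    emb₁ ι v (x, (Sum.inr (Sum.inl a), k)) = v (x, (a, k)) := rfl

/-- [folklore] entries of `emb₁` on the third summand. -/
@[simp] theorem emb₁_inr_inr (v : Λ × (C × D) → ℝ) (x : Λ) (i : ι) (k : D) : emb₁ ι v (x, (Sum.inr (Sum.inr i), k)) = 0 := rfl

end Defs

/-! ## §1 The fields of the embedded coordinates -/

section Field

variable {𝔸 : Type*} [NormedRing 𝔸] [NormedAlgebra ℝ 𝔸]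
variable {Λ : Type*} {C : Type*} [Fintype C] {ι : Type*} [Fintype ι] {D : Type*}

omit [Fintype ι] in
/-- [folklore] `field` is additive in the coordinates (any family). -/
theorem field_add {C' : Type*} [Fintype C'] (T : C' → 𝔸) (V W : Λ × (C' × D) → ℝ) :
    field T (V + W) = field T V + field T W := by
  funext x k
  simp only [field, Pi.add_apply, add_smul, Finset.sum_add_distrib]

/-- [folklore] **THE FIRST SUMMAND CARRIES THE ORIGINAL FLUCTUATION**: `field (rotFam t Y y) (emb₀ v) = field t v`. -/
theorem field_rotFam_emb₀ (t : C → 𝔸) (Y : 𝔸) (y : ι → 𝔸) (v : Λ × (C × D) → ℝ) :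
    field (rotFam t Y y) (emb₀ ι v) = field t v := by
  funext x k
  simp only [field, Fintype.sum_sum_type, rotFam, Sum.elim_inl, Sum.elim_inr, emb₀_inl, emb₀_inr, zero_smul,
    Finset.sum_const_zero, add_zero]

/-- [folklore] **THE SECOND SUMMAND CARRIES THE ROTATED FLUCTUATION**: `field (rotFam t Y y) (emb₁ w) x k = Y·(field t w x k) − (field t w x k)·Y`. -/
theorem field_rotFam_emb₁ (t : C → 𝔸) (Y : 𝔸) (y : ι → 𝔸) (w : Λ × (C × D) → ℝ) (x : Λ) (k : D) :
    field (rotFam t Y y) (emb₁ ι w) x k = Y * field t w x k - field t w x k * Y := by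
  simp only [field, Fintype.sum_sum_type, rotFam, Sum.elim_inl, Sum.elim_inr, emb₁_inl, emb₁_inr_inl, emb₁_inr_inr, zero_smul,
    Finset.sum_const_zero, zero_add, add_zero, smul_sub, Finset.sum_sub_distrib, Finset.mul_sum, Finset.sum_mul, smul_mul_assoc,
    mul_smul_comm]

/-- [folklore] **THE CONJUGATED FLUCTUATION IS A COORDINATE FIELD OF THE EXTENDED FAMILY**: for `λ = ℓ • Y`,
`adj λ (field t v) = field (rotFam t Y y) (emb₁ (ℓ ⊙ v))` (`WilsonStencilDivergence.adj_smul_field`). -/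
theorem adj_smul_field_rotFam (t : C → 𝔸) (Y : 𝔸) (y : ι → 𝔸) (ell : Λ → ℝ) (v : Λ × (C × D) → ℝ) :
    adj (fun x => ell x • Y) (field t v) = field (rotFam t Y y) (emb₁ ι (siteMul ell v)) := by
  funext x k
  rw [field_rotFam_emb₁, adj_smul_field]

end Field

/-! ## §2 The `(2,1)`-jet of a coordinate field as a quadratic form, its `W`-polarisation, the rotated background -/

section QuadForms

variable {𝔸 : Type*} [NormedRing 𝔸] [NormedAlgebra ℝ 𝔸]
variable {Λ : Type*} [Fintype Λ] [DecidableEq Λ] [AddCommGroup Λ] {C' : Type*} [Fintype C'] {D : Type*} [Fintype D]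
  [DecidableEq D]

/-- [folklore] an3's every-background headline with the factor `−½` cleared:
`jet21 (field T V) B = −V ⬝ᵥ wilsonVertexOp e (adM τ T (B ·)) V`. -/
theorem jet21_field_eq_neg_quadForm (τ : 𝔸 →ₗ[ℝ] ℝ) (hτ : ∀ a b : 𝔸, τ (a * b) = τ (b * a)) (T : C' → 𝔸) (e : D → Λ)
    (V : Λ × (C' × D) → ℝ) (B : Λ → D → 𝔸) :
    jet21 ℝ τ e (field T V) B = -(V ⬝ᵥ (wilsonVertexOp e (fun z γ => adM τ T (B z γ)) *ᵥ V)) := by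
  have h := actionJet21_eq_wilsonVertexOp τ hτ T e V B
  linarith

/-- [folklore] **THE `W`-POLARISATION OF THE `(2,1)`-JET BETWEEN TWO COORDINATE FIELDS OF ONE FAMILY**:
`jet21 (field T (V + W)) B − jet21 (field T V) B − jet21 (field T W) B = −(V ⬝ᵥ M W + W ⬝ᵥ M V)`, `M = wilsonVertexOp e (adM τ T (B ·))`. -/
theorem jet21_polar_field (τ : 𝔸 →ₗ[ℝ] ℝ) (hτ : ∀ a b : 𝔸, τ (a * b) = τ (b * a)) (T : C' → 𝔸) (e : D → Λ)
    (V W : Λ × (C' × D) → ℝ) (B : Λ → D → 𝔸) :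
    jet21 ℝ τ e (field T (V + W)) B - jet21 ℝ τ e (field T V) B - jet21 ℝ τ e (field T W) B =
      -(V ⬝ᵥ (wilsonVertexOp e (fun z γ => adM τ T (B z γ)) *ᵥ W) + W ⬝ᵥ (wilsonVertexOp e (fun z γ => adM τ T (B z γ)) *ᵥ V)) := by
  rw [jet21_field_eq_neg_quadForm τ hτ, jet21_field_eq_neg_quadForm τ hτ, jet21_field_eq_neg_quadForm τ hτ, Matrix.mulVec_add,
    dotProduct_add, add_dotProduct, add_dotProduct]
  ring

omit [Fintype Λ] [DecidableEq Λ] [Fintype D] [DecidableEq D] in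
/-- [folklore] the rotated background of `jet22_bgWard` for the parameter `λ = ℓ • Y`: the endpoint-sum conjugation of `B` by `λ` is
`(ℓ z + ℓ (z + e γ)) • (Y·B z γ − B z γ·Y)`. -/
theorem rotBackground_smul (e : D → Λ) (B : Λ → D → 𝔸) (ell : Λ → ℝ) (Y : 𝔸) :
    (fun z γ => (ell z • Y + ell (z + e γ) • Y) * B z γ - B z γ * (ell z • Y + ell (z + e γ) • Y)) =
      fun z γ => (ell z + ell (z + e γ)) • (Y * B z γ - B z γ * Y) := by
  funext z γ
  rw [← add_smul, smul_mul_assoc, mul_smul_comm, smul_sub]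

end QuadForms

/-! ## §3 The second-order background Ward identity as a law of quadratic forms -/

section Main

variable {𝔸 : Type*} [NormedRing 𝔸] [NormedAlgebra ℝ 𝔸]
variable {Λ : Type*} [Fintype Λ] [DecidableEq Λ] [AddCommGroup Λ] {C : Type*} [Fintype C] {ι : Type*} [Fintype ι]
  {D : Type*} [Fintype D] [DecidableEq D]

/-- [folklore] **THE SECOND-ORDER BACKGROUND-GAUGE WARD IDENTITY OF THE WILSON PLAQUETTE JETS AS A QUADRATIC-FORM LAW.**  For every
finite lattice `Λ` with frame `e`, normed real algebra `𝔸` with tracial `τ`, letter family `t : C → 𝔸`, letters `Y` and `y : ι → 𝔸`,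
background `B`, site profile `ℓ` and fluctuation coordinates `v`, with `T = rotFam t Y y`, `V₀ = emb₀ v`, `V₁ = emb₁ (ℓ ⊙ v)`,
`W₀ = gaugeDir₀ e (ℓ • Y)` and `M_X = wilsonVertexOp e (adM τ T (X ·))`:
`4·V₀ ⬝ᵥ (hess22 T (B + W₀) − hess22 T B − hess22 T W₀) V₀ − 4·(V₀ ⬝ᵥ M_B V₁ + V₁ ⬝ᵥ M_B V₀) − 2·V₀ ⬝ᵥ M_rot V₀ = 0`,
`rot z γ = (ℓ z + ℓ (z + e γ)) • (Y·B z γ − B z γ·Y)` — this lineage's `jet22_bgWard` at `W = field t v`, `λ = ℓ • Y`, read through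
`jet22_field_quadForm`, `jet21_polar_field`, `jet21_field_eq_neg_quadForm` in the extended family (§1).  The three terms are, in
order: the response of the `(2,2)` Hessian to the pure-gauge background `W₀λ` (the DIVERGENCE side), the `(2,1)` Hessian between the
fluctuation and its conjugate by `λ` (the COMMUTATOR side), and the `(2,1)` Hessian at the rotated background (the REMAINDER). -/
theorem bgWard22_quadForm (τ : 𝔸 →ₗ[ℝ] ℝ) (hτ : ∀ a b : 𝔸, τ (a * b) = τ (b * a)) (t : C → 𝔸) (Y : 𝔸) (y : ι → 𝔸)
    (e : D → Λ) (B : Λ → D → 𝔸) (ell : Λ → ℝ) (v : Λ × (C × D) → ℝ) :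
    4 * (emb₀ ι v ⬝ᵥ ((hess22 τ (rotFam t Y y) e (B + gaugeDir₀ e (fun x => ell x • Y)) - hess22 τ (rotFam t Y y) e B
          - hess22 τ (rotFam t Y y) e (gaugeDir₀ e (fun x => ell x • Y))) *ᵥ emb₀ ι v))
      - 4 * (emb₀ ι v ⬝ᵥ (wilsonVertexOp e (fun z γ => adM τ (rotFam t Y y) (B z γ)) *ᵥ emb₁ ι (siteMul ell v))
          + emb₁ ι (siteMul ell v) ⬝ᵥ (wilsonVertexOp e (fun z γ => adM τ (rotFam t Y y) (B z γ)) *ᵥ emb₀ ι v))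
      - 2 * (emb₀ ι v ⬝ᵥ (wilsonVertexOp e
          (fun z γ => adM τ (rotFam t Y y) ((ell z + ell (z + e γ)) • (Y * B z γ - B z γ * Y))) *ᵥ emb₀ ι v)) = 0 := by
  have h := jet22_bgWard ℝ τ hτ e (field t v) B (fun x => ell x • Y)
  rw [rotBackground_smul, adj_smul_field_rotFam t Y y, ← field_rotFam_emb₀ t Y y v, ← field_add,
    jet22_field_quadForm τ hτ, jet22_field_quadForm τ hτ, jet22_field_quadForm τ hτ] at h
  simp only [jet21_field_eq_neg_quadForm τ hτ, smul_eq_mul, Matrix.mulVec_add, dotProduct_add, add_dotProduct, Matrix.sub_mulVec,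
    dotProduct_sub] at h ⊢
  linarith

end Main

end Summit.QuantumFields.BalabanUV.Beta.WilsonBiStencilWardFrame
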